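import Summits.QuantumFields.YangMills.Theorems.PoincareLipschitzSobolevInversion
import HarnessLib

/-!
# Conformal identities for the Sobolev transport under the planar inversion (ROAD (W), brick W-INV, part 3)

Helper file (K2 lane of crux `stmt-QuantumFields-19936` `HistoryTailL` ∕ crux `stmt-QuantumFields-23533`
`BlockLipschitzL`, LINE 25 «CompactnessTransfer», ROAD (W) «the H-system energy gap at `3π` from the
sharp two-point Wente bound», brick W-INV).  YM₃ on the unit 3-torus is rung R3 of the ladder — NOT
`d = 4`, NOT infinite volume, NOT a mass gap, NOT the Clay problem; nothing here bears on those.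

`M = EuclideanGeometry.inversion c 1` on `E² = EuclideanSpace ℝ (Fin 2)`, `e k = EuclideanSpace.single k 1`,
transported derivative `G̃(y) = G(M y) ∘L DM(y)`.  Because `DM(y) = ‖y−c‖⁻² S` with `S` a reflection:

* §1 pointwise: the Dirichlet pairing scales by `‖y−c‖⁻⁴` (`sum_mul_comp_fderiv_inversion`), so does
  the energy density; the Jacobian scales by `−‖y−c‖⁻⁴` (`det_comp_fderiv_inversion`, orientation
  reversal);
* §2 integrated (change of variables of part 1): the Dirichlet energy is invariant
  (`integral_energy_comp_inversion`, with integrability), the Dirichlet pairing against a test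
  function is invariant (`integral_pairing_comp_inversion`), and `∫ θ · det(G̃a, G̃b) = −∫ (θ∘M) · det(Ga, Gb)`
  (`integral_mul_det_comp_inversion`);
* §3 hence the weak H-system ∕ Wente row `−∫ Σ_k ∂_kη · Gu e_k = 2 ∫ η · det(Ga, Gb)` for tests on
  `{c}ᶜ` transports to the inverted triple `(u∘M; b∘M, a∘M)` (note the swap) —
  `hSystemRow_comp_inversion`.

References: H. Brezis, J.-M. Coron, Arch. Rational Mech. Anal. 89 (1985), Appendix p. 48.
-/

noncomputable section

open MeasureTheory Set Filter Metric Module EuclideanGeometry TopologicalSpace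
open scoped ENNReal Topology RealInnerProductSpace ContDiff

namespace Summit.QuantumFields.YangMills.Theorems.PoincareLipschitzSobolevInversion

open Literature.Analysis.FunctionSpaces

/-! ## §1 Pointwise conformal identities -/

/-- Coordinates of `DM(y) e_k`: `(DM(y) e_k)ⱼ = ‖y−c‖⁻² δⱼₖ − 2 (y−c)ₖ (y−c)ⱼ ‖y−c‖⁻⁴`. [folklore] -/
theorem fderiv_inversion_single_coord {c y : EuclideanSpace ℝ (Fin 2)} (hy : y ≠ c) (k j : Fin 2) :
    fderiv ℝ (inversion c 1) y (EuclideanSpace.single k 1) j =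
      (‖y - c‖ ^ 2)⁻¹ * (if j = k then 1 else 0) - 2 * (y - c) k * ((‖y - c‖ ^ 2)⁻¹) ^ 2 * (y - c) j := by
  rw [fderiv_inversion_apply_coord hy, EuclideanSpace.inner_single_right]
  simp [PiLp.single_apply]

/-- **The Dirichlet pairing scales by `‖y−c‖⁻⁴`**: for linear functionals `P, Q` on `E²`,
`Σ_k P(DM(y) e_k) Q(DM(y) e_k) = ‖y−c‖⁻⁴ Σ_k P(e_k) Q(e_k)` (`DM(y)` is `‖y−c‖⁻²` times a reflection).
[folklore] -/
theorem sum_mul_comp_fderiv_inversion {c y : EuclideanSpace ℝ (Fin 2)} (hy : y ≠ c)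
    (P Q : EuclideanSpace ℝ (Fin 2) →L[ℝ] ℝ) :
    ∑ k : Fin 2, P (fderiv ℝ (inversion c 1) y (EuclideanSpace.single k 1)) *
        Q (fderiv ℝ (inversion c 1) y (EuclideanSpace.single k 1)) =
      ((‖y - c‖ ^ 2)⁻¹) ^ 2 * ∑ k : Fin 2, P (EuclideanSpace.single k 1) * Q (EuclideanSpace.single k 1) := by
  have hz : ‖y - c‖ ^ 2 ≠ 0 := pow_ne_zero 2 (norm_ne_zero_iff.2 (sub_ne_zero.2 hy))
  have hn : ‖y - c‖ ^ 2 = (y - c) 0 ^ 2 + (y - c) 1 ^ 2 := by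
    rw [EuclideanSpace.real_norm_sq_eq, Fin.sum_univ_two]
  have hP : ∀ k, P (fderiv ℝ (inversion c 1) y (EuclideanSpace.single k 1)) =
      ∑ j : Fin 2, fderiv ℝ (inversion c 1) y (EuclideanSpace.single k 1) j * P (EuclideanSpace.single j 1) :=
    fun k => by rw [clm_apply_eq_sum P]; simp only [smul_eq_mul]
  have hQ : ∀ k, Q (fderiv ℝ (inversion c 1) y (EuclideanSpace.single k 1)) =
      ∑ j : Fin 2, fderiv ℝ (inversion c 1) y (EuclideanSpace.single k 1) j * Q (EuclideanSpace.single j 1) :=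
    fun k => by rw [clm_apply_eq_sum Q]; simp only [smul_eq_mul]
  simp_rw [hP, hQ, fderiv_inversion_single_coord hy, Fin.sum_univ_two]
  simp only [Fin.isValue, if_true, one_ne_zero, if_false, zero_ne_one]
  rw [hn] at hz ⊢
  field_simp
  ring

/-- **The Jacobian scales by `−‖y−c‖⁻⁴`** (the inversion reverses orientation): for linear
functionals `P, Q` on `E²`,
`P(DM e₀) Q(DM e₁) − P(DM e₁) Q(DM e₀) = −‖y−c‖⁻⁴ (P e₀ Q e₁ − P e₁ Q e₀)`. [folklore] -/
theorem det_comp_fderiv_inversion {c y : EuclideanSpace ℝ (Fin 2)} (hy : y ≠ c)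
    (P Q : EuclideanSpace ℝ (Fin 2) →L[ℝ] ℝ) :
    P (fderiv ℝ (inversion c 1) y (EuclideanSpace.single 0 1)) * Q (fderiv ℝ (inversion c 1) y (EuclideanSpace.single 1 1)) -
        P (fderiv ℝ (inversion c 1) y (EuclideanSpace.single 1 1)) * Q (fderiv ℝ (inversion c 1) y (EuclideanSpace.single 0 1)) =
      -(((‖y - c‖ ^ 2)⁻¹) ^ 2) *
        (P (EuclideanSpace.single 0 1) * Q (EuclideanSpace.single 1 1) -
          P (EuclideanSpace.single 1 1) * Q (EuclideanSpace.single 0 1)) := by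
  have hz : ‖y - c‖ ^ 2 ≠ 0 := pow_ne_zero 2 (norm_ne_zero_iff.2 (sub_ne_zero.2 hy))
  have hn : ‖y - c‖ ^ 2 = (y - c) 0 ^ 2 + (y - c) 1 ^ 2 := by
    rw [EuclideanSpace.real_norm_sq_eq, Fin.sum_univ_two]
  have hP : ∀ k, P (fderiv ℝ (inversion c 1) y (EuclideanSpace.single k 1)) =
      ∑ j : Fin 2, fderiv ℝ (inversion c 1) y (EuclideanSpace.single k 1) j * P (EuclideanSpace.single j 1) :=
    fun k => by rw [clm_apply_eq_sum P]; simp only [smul_eq_mul]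
  have hQ : ∀ k, Q (fderiv ℝ (inversion c 1) y (EuclideanSpace.single k 1)) =
      ∑ j : Fin 2, fderiv ℝ (inversion c 1) y (EuclideanSpace.single k 1) j * Q (EuclideanSpace.single j 1) :=
    fun k => by rw [clm_apply_eq_sum Q]; simp only [smul_eq_mul]
  simp_rw [hP, hQ, fderiv_inversion_single_coord hy, Fin.sum_univ_two]
  simp only [Fin.isValue, if_true, one_ne_zero, if_false, zero_ne_one]
  rw [hn] at hz ⊢
  field_simp
  ring

/-- **Energy density**: `Σ_k (G̃(y) e_k)² = ‖y−c‖⁻⁴ · Σ_k (G(M y) e_k)²`. [folklore] -/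
theorem energy_comp_fderiv_inversion {c y : EuclideanSpace ℝ (Fin 2)} (hy : y ≠ c)
    (P : EuclideanSpace ℝ (Fin 2) →L[ℝ] ℝ) :
    ∑ k : Fin 2, (P.comp (fderiv ℝ (inversion c 1) y) (EuclideanSpace.single k 1)) ^ 2 =
      ((‖y - c‖ ^ 2)⁻¹) ^ 2 * ∑ k : Fin 2, (P (EuclideanSpace.single k 1)) ^ 2 := by
  simpa only [ContinuousLinearMap.comp_apply, sq] using sum_mul_comp_fderiv_inversion hy P P

/-! ## §2 Integrated identities -/

/-- **Energy invariance**: `∫ Σ_k (G̃ e_k)² = ∫ Σ_k (G e_k)²` for `G̃(y) = G(M y) ∘L DM(y)`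
(no integrability needed: both sides are integrals of nonnegative functions, equal by the change of
variables of part 1). [cite: BrezisCoron1985, Appendix p. 48 (inversion step)] -/
theorem integral_energy_comp_inversion (c : EuclideanSpace ℝ (Fin 2))
    (G : EuclideanSpace ℝ (Fin 2) → EuclideanSpace ℝ (Fin 2) →L[ℝ] ℝ) :
    ∫ y, ∑ k : Fin 2, ((G (inversion c 1 y)).comp (fderiv ℝ (inversion c 1) y) (EuclideanSpace.single k 1)) ^ 2 =
      ∫ x, ∑ k : Fin 2, (G x (EuclideanSpace.single k 1)) ^ 2 := by
  rw [← integral_comp_inversion c (fun x => ∑ k : Fin 2, (G x (EuclideanSpace.single k 1)) ^ 2)]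
  refine integral_congr_ae ?_
  filter_upwards [Measure.ae_ne volume c] with y hy
  rw [energy_comp_fderiv_inversion hy, smul_eq_mul]

/-- **Energy integrability transports**: `Σ_k (G̃ e_k)²` is integrable iff `Σ_k (G e_k)²` is. [folklore] -/
theorem integrable_energy_comp_inversion_iff (c : EuclideanSpace ℝ (Fin 2))
    (G : EuclideanSpace ℝ (Fin 2) → EuclideanSpace ℝ (Fin 2) →L[ℝ] ℝ) :
    Integrable (fun y => ∑ k : Fin 2,
        ((G (inversion c 1 y)).comp (fderiv ℝ (inversion c 1) y) (EuclideanSpace.single k 1)) ^ 2) ↔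
      Integrable (fun x => ∑ k : Fin 2, (G x (EuclideanSpace.single k 1)) ^ 2) := by
  rw [← integrable_comp_inversion_iff c (fun x => ∑ k : Fin 2, (G x (EuclideanSpace.single k 1)) ^ 2)]
  refine integrable_congr ?_
  filter_upwards [Measure.ae_ne volume c] with y hy
  rw [energy_comp_fderiv_inversion hy, smul_eq_mul]

/-- **Invariance of the Dirichlet pairing against test functions**: for `θ` differentiable,
`∫ Σ_k ∂_kθ · G̃u e_k = ∫ Σ_k ∂_k(θ ∘ M) · Gu e_k`. [cite: BrezisCoron1985, Appendix p. 48 (inversion step)] -/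
theorem integral_pairing_comp_inversion (c : EuclideanSpace ℝ (Fin 2))
    (Gu : EuclideanSpace ℝ (Fin 2) → EuclideanSpace ℝ (Fin 2) →L[ℝ] ℝ) {θ : EuclideanSpace ℝ (Fin 2) → ℝ}
    (hθ : Differentiable ℝ θ) :
    ∫ y, ∑ k : Fin 2, fderiv ℝ θ y (EuclideanSpace.single k 1) *
        (Gu (inversion c 1 y)).comp (fderiv ℝ (inversion c 1) y) (EuclideanSpace.single k 1) =
      ∫ x, ∑ k : Fin 2, fderiv ℝ (fun x => θ (inversion c 1 x)) x (EuclideanSpace.single k 1) *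
        Gu x (EuclideanSpace.single k 1) := by
  rw [← integral_comp_inversion c (fun x => ∑ k : Fin 2,
    fderiv ℝ (fun x => θ (inversion c 1 x)) x (EuclideanSpace.single k 1) * Gu x (EuclideanSpace.single k 1))]
  refine integral_congr_ae ?_
  filter_upwards [Measure.ae_ne volume c] with y hy
  -- `θ = (θ ∘ M) ∘ M`, chain rule at `y`
  have hM : DifferentiableAt ℝ (inversion c 1) y := (hasFDerivAt_inversion (R := 1) hy).differentiableAt
  have hηd : DifferentiableAt ℝ (fun x => θ (inversion c 1 x)) (inversion c 1 y) :=
    (hθ _).comp _ (hasFDerivAt_inversion (R := 1) (inversion_ne_center hy)).differentiableAt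
  have hθeq : θ = fun z => (fun x => θ (inversion c 1 x)) (inversion c 1 z) := by
    funext z; simp only [inversion_inversion_one]
  have hchain : ∀ k, fderiv ℝ θ y (EuclideanSpace.single k 1) =
      fderiv ℝ (fun x => θ (inversion c 1 x)) (inversion c 1 y)
        (fderiv ℝ (inversion c 1) y (EuclideanSpace.single k 1)) := by
    intro k
    conv_lhs => rw [hθeq]
    rw [fderiv_fun_comp y hηd hM, ContinuousLinearMap.comp_apply]
  simp only [ContinuousLinearMap.comp_apply, hchain, smul_eq_mul]
  exact sum_mul_comp_fderiv_inversion hy _ _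

/-- **The Jacobian paired with a test function**: `∫ θ · det(G̃a, G̃b) = −∫ (θ ∘ M) · det(Ga, Gb)`
(orientation reversal; change of variables). [cite: BrezisCoron1985, Appendix p. 48 (inversion step)] -/
theorem integral_mul_det_comp_inversion (c : EuclideanSpace ℝ (Fin 2))
    (Ga Gb : EuclideanSpace ℝ (Fin 2) → EuclideanSpace ℝ (Fin 2) →L[ℝ] ℝ) (θ : EuclideanSpace ℝ (Fin 2) → ℝ) :
    ∫ y, θ y *
        ((Ga (inversion c 1 y)).comp (fderiv ℝ (inversion c 1) y) (EuclideanSpace.single 0 1) *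
            (Gb (inversion c 1 y)).comp (fderiv ℝ (inversion c 1) y) (EuclideanSpace.single 1 1) -
          (Ga (inversion c 1 y)).comp (fderiv ℝ (inversion c 1) y) (EuclideanSpace.single 1 1) *
            (Gb (inversion c 1 y)).comp (fderiv ℝ (inversion c 1) y) (EuclideanSpace.single 0 1)) =
      -∫ x, θ (inversion c 1 x) *
        (Ga x (EuclideanSpace.single 0 1) * Gb x (EuclideanSpace.single 1 1) -
          Ga x (EuclideanSpace.single 1 1) * Gb x (EuclideanSpace.single 0 1)) := by
  rw [← integral_neg, ← integral_comp_inversion c (fun x => -(θ (inversion c 1 x) *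
    (Ga x (EuclideanSpace.single 0 1) * Gb x (EuclideanSpace.single 1 1) -
      Ga x (EuclideanSpace.single 1 1) * Gb x (EuclideanSpace.single 0 1))))]
  refine integral_congr_ae ?_
  filter_upwards [Measure.ae_ne volume c] with y hy
  simp only [ContinuousLinearMap.comp_apply, inversion_inversion_one, smul_eq_mul]
  rw [det_comp_fderiv_inversion hy]
  ring

/-! ## §3 The Wente ∕ H-system row off the pole -/

/-- **The Wente row transports (tests off the pole)**: if `−∫ Σ_k ∂_kη · Gu e_k = 2 ∫ η det(Ga, Gb)`
for all test functions `η` on `{c}ᶜ`, then the inverted triple `(u∘M; b∘M, a∘M)` (note the SWAP,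
compensating the orientation reversal) satisfies the same row for all test functions on `{c}ᶜ`,
with the transported derivatives `G̃(y) = G(M y) ∘L DM(y)`. [cite: BrezisCoron1985, Appendix p. 48 (inversion step)] -/
theorem wenteRow_comp_inversion {c : EuclideanSpace ℝ (Fin 2)}
    {Gu Ga Gb : EuclideanSpace ℝ (Fin 2) → EuclideanSpace ℝ (Fin 2) →L[ℝ] ℝ}
    (h : ∀ η : EuclideanSpace ℝ (Fin 2) → ℝ, IsTestFunctionOn ⟨{c}ᶜ, isOpen_compl_singleton⟩ η →
      -(∫ x, ∑ k : Fin 2, fderiv ℝ η x (EuclideanSpace.single k 1) * Gu x (EuclideanSpace.single k 1)) =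
        2 * ∫ x, η x * (Ga x (EuclideanSpace.single 0 1) * Gb x (EuclideanSpace.single 1 1) -
          Ga x (EuclideanSpace.single 1 1) * Gb x (EuclideanSpace.single 0 1)))
    (θ : EuclideanSpace ℝ (Fin 2) → ℝ) (hθ : IsTestFunctionOn ⟨{c}ᶜ, isOpen_compl_singleton⟩ θ) :
    -(∫ y, ∑ k : Fin 2, fderiv ℝ θ y (EuclideanSpace.single k 1) *
        (Gu (inversion c 1 y)).comp (fderiv ℝ (inversion c 1) y) (EuclideanSpace.single k 1)) =
      2 * ∫ y, θ y *
        ((Gb (inversion c 1 y)).comp (fderiv ℝ (inversion c 1) y) (EuclideanSpace.single 0 1) *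
            (Ga (inversion c 1 y)).comp (fderiv ℝ (inversion c 1) y) (EuclideanSpace.single 1 1) -
          (Gb (inversion c 1 y)).comp (fderiv ℝ (inversion c 1) y) (EuclideanSpace.single 1 1) *
            (Ga (inversion c 1 y)).comp (fderiv ℝ (inversion c 1) y) (EuclideanSpace.single 0 1)) := by
  rw [integral_pairing_comp_inversion c Gu (hθ.contDiff.differentiable (by simp)),
    h _ (isTestFunctionOn_comp_inversion hθ), integral_mul_det_comp_inversion c Gb Ga θ, ← integral_neg]
  congr 1
  refine integral_congr_ae (Eventually.of_forall fun x => ?_)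
  ring

end Summit.QuantumFields.YangMills.Theorems.PoincareLipschitzSobolevInversion

end
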